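import Mathlib.GroupTheory.Perm.Cycle.Basic
import Mathlib.Algebra.Order.BigOperators.Group.Finset
import Mathlib.Algebra.BigOperators.Fin
import Mathlib.Tactic.Linarith
import Mathlib.Tactic.Ring

/-!
# Route «KPlusLogSqLaw», crux `TropicalB` (stmt-ValiantsHypothesis-19771) — LEX-NT, part 1 (combinatorics):
# a Hamiltonian cycle `π`, a second permutation `ρ` with few fixed points and few coincidences with `π` ⇒ a DESCENT of `ρ`
# in the `π`-order (the alternating cycle of the Latin triple)

HONEST FRAMING.  Pure combinatorics of permutations of `Fin m` (no designs, no dominance); part 1 of the all-`m` law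
«fast digits are never counting-tight at `K = 4`, `m ≥ 4`» (LEX-NT, conjectured with kernel/exact/located evidence `m ≤ 9` by
seat val-sym-trop-p5 g13, `K4-ANATOMY-g13.md` §3b–3d; proved for all `m` by this seat, g14, 2026-08-28; cell `pub-symmetroid`,
`--supports stmt-ValiantsHypothesis-19771 --as helper`).  Nothing here bears on `TropicalB` in its window, `WeakLifting`,
DoorA26 / DoorA34, `MatrixDescartes` (stmt-ValiantsHypothesis-18050) or VP ≠ VNP.

CONTENT.  Let `π` be a permutation of `Fin m` moving every point, with every point in the cycle of `bs` (a Hamiltonian cycle: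
the quotient `α⁻¹β` of the first two core terms, `ParityLaw.hamiltonian_quotient`).
* `exists_order` — the `π`-ORDER: an injective `pos : Fin m → ℕ`, `pos < m`, with `pos bs = m − 1` and `pos (π b) = pos b + 1`
  for `b ≠ bs` (namely `pos (π^(i+1) bs) = i`; the iterates enumerate `Fin m` because `π` has order `m`).
* `exists_descent` — **THE DESCENT LEMMA.**  `m ≥ 4`; `pos` as above; `ρ` a permutation whose fixed points lie in `{y}` and whose
  coincidences with `π` (`π b = ρ b`) lie in `{x, y}`, `x ≠ y`.  Then some `b ≠ x` with `ρ b ≠ b` has `pos (ρ b) < pos b`.  Proof: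
  the displacements `pos (ρ b) − pos b` sum to `0`; if no such `b` existed they would be `≥ 2` off `{x, y, bs}` (a displacement
  of exactly `1` off `bs` is a coincidence), `≥ 1` at `bs`, `≥ 0` at `y`, and `≥ −(m−1)` at `x` (`≥ −(m−2)` unless `x = bs`):
  total `≥ m − 3 > 0`.  At `m = 3` the equality case `x = bs`, `ρ y = y` is exactly the realisable configuration of the fast-digit
  `(3,4)` cell, which IS counting-tight.
[this cell; elementary]
-/

set_option linter.dupNamespace false
set_option autoImplicit false

namespace Summit.ValiantsHypothesis.ValiantsHypothesis.Theorems.KPlusLogSqLaw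

namespace LexCore

open Finset

variable {m : ℕ}

section Order

variable {π : Equiv.Perm (Fin m)} {bs : Fin m}

/-- a permutation moving every point with all points in one cycle is a cycle. [folklore] -/
theorem isCycle_of_hamiltonian (hπ : ∀ b, π b ≠ b) (hc : ∀ b, π.SameCycle bs b) : π.IsCycle :=
  ⟨bs, hπ bs, fun b _ => hc b⟩

/-- … of full support. [folklore] -/
theorem support_eq_univ_of_moves [DecidableEq (Fin m)] (hπ : ∀ b, π b ≠ b) : π.support = univ := by
  ext b
  simp only [Equiv.Perm.mem_support, Finset.mem_univ, iff_true]
  exact hπ b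

/-- … hence of order `m`. [folklore] -/
theorem orderOf_eq (hπ : ∀ b, π b ≠ b) (hc : ∀ b, π.SameCycle bs b) : orderOf π = m := by
  classical
  rw [(isCycle_of_hamiltonian hπ hc).orderOf, support_eq_univ_of_moves hπ, Finset.card_univ, Fintype.card_fin]

/-- `π^m = 1`. [folklore] -/
theorem pow_m_apply (hπ : ∀ b, π b ≠ b) (hc : ∀ b, π.SameCycle bs b) (b : Fin m) : (π ^ m) b = b := by
  have h : π ^ orderOf π = 1 := pow_orderOf_eq_one π
  rw [orderOf_eq hπ hc] at h
  rw [h]; rfl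

/-- no proper power of `π` fixes the base column. [folklore] -/
theorem pow_apply_bs_ne (hπ : ∀ b, π b ≠ b) (hc : ∀ b, π.SameCycle bs b) {t : ℕ} (ht0 : 0 < t) (htm : t < m) :
    (π ^ t) bs ≠ bs := by
  intro h
  have h1 : π ^ t = 1 := (isCycle_of_hamiltonian hπ hc).pow_eq_one_iff.2 ⟨bs, hπ bs, h⟩
  have h2 : orderOf π ∣ t := orderOf_dvd_of_pow_eq_one h1
  rw [orderOf_eq hπ hc] at h2
  exact absurd (Nat.le_of_dvd ht0 h2) (not_le.mpr htm)

/-- iterates `π^(i+1) bs` with indices `i < j < m` differ. [folklore] -/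
theorem iter_ne_of_lt (hπ : ∀ b, π b ≠ b) (hc : ∀ b, π.SameCycle bs b) {i j : ℕ} (hij : i < j) (hj : j < m) :
    (π ^ (i + 1)) bs ≠ (π ^ (j + 1)) bs := by
  intro h
  have e1 : (π ^ (j + 1)) bs = (π ^ (i + 1)) ((π ^ (j - i)) bs) := by
    rw [← Equiv.Perm.mul_apply, ← pow_add]
    congr 2
    omega
  rw [e1] at h
  have e2 : (π ^ (j - i)) bs = bs := (π ^ (i + 1)).injective h.symm
  exact pow_apply_bs_ne hπ hc (by omega) (by omega) e2

/-- **the iterates enumerate `Fin m`**: `i ↦ π^(i+1) bs` is injective on `i < m`. [folklore] -/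
theorem iter_injective (hπ : ∀ b, π b ≠ b) (hc : ∀ b, π.SameCycle bs b) :
    Function.Injective (fun i : Fin m => (π ^ (i.val + 1)) bs) := by
  intro i j h
  rcases lt_trichotomy i.val j.val with hlt | heq | hgt
  · exact absurd h (iter_ne_of_lt hπ hc hlt j.isLt)
  · exact Fin.ext heq
  · exact absurd h.symm (iter_ne_of_lt hπ hc hgt i.isLt)

/-- **THE `π`-ORDER.**  For a Hamiltonian `π` through `bs` there is an injective position function `pos < m` with `pos bs = m − 1`
and `pos (π b) = pos b + 1` off `bs` (namely `pos (π^(i+1) bs) = i`). [this cell] -/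
theorem exists_order (hπ : ∀ b, π b ≠ b) (hc : ∀ b, π.SameCycle bs b) :
    ∃ pos : Fin m → ℕ, Function.Injective pos ∧ (∀ b, pos b < m) ∧ pos bs = m - 1 ∧
      ∀ b, b ≠ bs → pos (π b) = pos b + 1 := by
  have hbij : Function.Bijective (fun i : Fin m => (π ^ (i.val + 1)) bs) :=
    Finite.injective_iff_bijective.mp (iter_injective hπ hc)
  set e : Fin m ≃ Fin m := Equiv.ofBijective _ hbij with he
  -- `e i = π^(i+1) bs`
  have he_apply : ∀ i : Fin m, e i = (π ^ (i.val + 1)) bs := fun i => by rw [he, Equiv.ofBijective_apply]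
  have hpos_iter : ∀ {i : ℕ} (hi : i < m), (e.symm ((π ^ (i + 1)) bs)).val = i := by
    intro i hi
    have h := e.symm_apply_apply ⟨i, hi⟩
    rw [he_apply] at h
    rw [h]
  refine ⟨fun b => (e.symm b).val, fun b b' h => e.symm.injective (Fin.ext h), fun b => (e.symm b).isLt, ?_, ?_⟩
  · -- the base column is last
    have hm : 0 < m := bs.pos
    have h := hpos_iter (i := m - 1) (by omega)
    rwa [show m - 1 + 1 = m by omega, pow_m_apply hπ hc] at h
  · -- `π` advances the position by one off the base column
    intro b hb
    simp only
    have hm : 0 < m := bs.pos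
    have hlt := (e.symm b).isLt
    have hb' : (π ^ ((e.symm b).val + 1)) bs = b := by rw [← he_apply, Equiv.apply_symm_apply]
    have hne : (e.symm b).val ≠ m - 1 := by
      intro h
      apply hb
      rw [← hb', h, show m - 1 + 1 = m by omega, pow_m_apply hπ hc]
    have e2 : π b = (π ^ ((e.symm b).val + 1 + 1)) bs := by
      conv_lhs => rw [← hb']
      rw [← Equiv.Perm.mul_apply, ← pow_succ']
    rw [e2, hpos_iter (by omega)]

end Order

/-! ## The descent lemma -/

section Descent

variable {π ρ : Equiv.Perm (Fin m)} {bs x y : Fin m}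

/-- **THE DESCENT LEMMA.**  `pos` an injective position function with `pos < m`, `pos bs = m − 1`, `pos (π b) = pos b + 1` off `bs`
(the `π`-order of `exists_order`); `ρ` with fixed points only at `y` and coincidences with `π` only at `x` or `y` (`x ≠ y`); `m ≥ 4`.
Then some column `b ≠ x`, moved by `ρ`, DESCENDS: `pos (ρ b) < pos b`. [this cell] -/
theorem exists_descent (pos : Fin m → ℕ) (hinj : Function.Injective pos) (hlt : ∀ b, pos b < m) (hbs : pos bs = m - 1)
    (hstep : ∀ b, b ≠ bs → pos (π b) = pos b + 1) (hxy : x ≠ y)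
    (hfix : ∀ b, ρ b = b → b = y) (hcoin : ∀ b, π b = ρ b → b = x ∨ b = y) (hm : 4 ≤ m) :
    ∃ b, b ≠ x ∧ ρ b ≠ b ∧ pos (ρ b) < pos b := by
  classical
  by_contra H
  push Not at H
  -- `H : ∀ b, b ≠ x → ρ b ≠ b → pos b ≤ pos (ρ b)`
  set P : Fin m → ℤ := fun b => (pos b : ℤ) with hP
  set δ : Fin m → ℤ := fun b => P (ρ b) - P b with hδ
  -- displacements sum to zero
  have hsum : ∑ b, δ b = 0 := by
    simp only [hδ, Finset.sum_sub_distrib]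
    rw [Equiv.sum_comp ρ (fun b => P b), sub_self]
  -- bounds on positions
  have hPnn : ∀ b, 0 ≤ P b := fun b => by simp only [hP]; positivity
  have hPlt : ∀ b, P b ≤ (m : ℤ) - 1 := fun b => by
    simp only [hP]
    have := hlt b
    omega
  -- the displacement at `x`
  have hx1 : -((m : ℤ) - 1) ≤ δ x := by
    simp only [hδ]; linarith [hPnn (ρ x), hPlt x]
  have hx2 : x ≠ bs → -((m : ℤ) - 2) ≤ δ x := by
    intro hxbs
    have hne : pos x ≠ m - 1 := by
      intro h; apply hxbs; apply hinj; rw [h, hbs]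
    have hlt' := hlt x
    have : P x ≤ (m : ℤ) - 2 := by simp only [hP]; omega
    simp only [hδ]; linarith [hPnn (ρ x)]
  -- the displacement at `y`
  have hy0 : 0 ≤ δ y := by
    by_cases hfy : ρ y = y
    · simp only [hδ, hfy, sub_self]; exact le_refl _
    · have := H y hxy.symm hfy
      simp only [hδ, hP]; omega
  -- the displacement elsewhere: `≥ 1`, and `≥ 2` off `bs`
  have hR : ∀ b, b ≠ x → b ≠ y → (if b = bs then (1 : ℤ) else 2) ≤ δ b := by
    intro b hbx hby
    have hmv : ρ b ≠ b := fun h => hby (hfix b h)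
    have hle := H b hbx hmv
    have hlt' : pos b < pos (ρ b) := by
      rcases lt_or_eq_of_le hle with h | h
      · exact h
      · exact absurd (hinj h).symm hmv
    by_cases hbbs : b = bs
    · rw [if_pos hbbs]; simp only [hδ, hP]; omega
    · rw [if_neg hbbs]
      -- a displacement of exactly one is a coincidence
      have hne1 : pos (ρ b) ≠ pos b + 1 := by
        intro h1
        rw [← hstep b hbbs] at h1
        have hco : π b = ρ b := (hinj h1).symm
        rcases hcoin b hco with h | h
        · exact hbx h
        · exact hby h
      simp only [hδ, hP]; omega
  -- sum over the remaining columns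
  have hyR : y ∈ (univ : Finset (Fin m)).erase x := Finset.mem_erase.mpr ⟨hxy.symm, Finset.mem_univ _⟩
  set R : Finset (Fin m) := ((univ : Finset (Fin m)).erase x).erase y with hRdef
  have hcardR : R.card = m - 2 := by
    simp only [hRdef]
    rw [Finset.card_erase_of_mem hyR, Finset.card_erase_of_mem (Finset.mem_univ _), Finset.card_univ, Fintype.card_fin]
    omega
  have hsplit : ∑ b, δ b = δ x + (δ y + ∑ b ∈ R, δ b) := by
    rw [← Finset.add_sum_erase _ _ (Finset.mem_univ x), ← Finset.add_sum_erase _ _ hyR]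
  have hmemR : ∀ b, b ∈ R ↔ b ≠ x ∧ b ≠ y := by
    intro b
    simp only [hRdef, Finset.mem_erase, Finset.mem_univ, and_true]
    tauto
  -- lower bound for the sum over `R`
  have hRsum : (if x ≠ bs ∧ y ≠ bs then 2 * ((m : ℤ) - 2) - 1 else 2 * ((m : ℤ) - 2)) ≤ ∑ b ∈ R, δ b := by
    by_cases hbsR : bs ∈ R
    · obtain ⟨hbx, hby⟩ := (hmemR bs).mp hbsR
      rw [if_pos ⟨fun h => hbx h.symm, fun h => hby h.symm⟩]
      rw [← Finset.add_sum_erase _ _ hbsR]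
      have h1 : (1 : ℤ) ≤ δ bs := by simpa using hR bs hbx hby
      have hcard' : (R.erase bs).card = m - 3 := by rw [Finset.card_erase_of_mem hbsR, hcardR]; omega
      have h2 : (R.erase bs).card • (2 : ℤ) ≤ ∑ b ∈ R.erase bs, δ b := by
        apply Finset.card_nsmul_le_sum
        intro b hb
        obtain ⟨hbbs, hbR⟩ := Finset.mem_erase.mp hb
        obtain ⟨hbx', hby'⟩ := (hmemR b).mp hbR
        simpa [hbbs] using hR b hbx' hby'
      rw [hcard', nsmul_eq_mul] at h2
      have hm3 : ((m - 3 : ℕ) : ℤ) = (m : ℤ) - 3 := by omega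
      rw [hm3] at h2
      linarith
    · have hcond : ¬ (x ≠ bs ∧ y ≠ bs) := by
        intro h
        exact hbsR ((hmemR bs).mpr ⟨fun e => h.1 e.symm, fun e => h.2 e.symm⟩)
      rw [if_neg hcond]
      have h2 : R.card • (2 : ℤ) ≤ ∑ b ∈ R, δ b := by
        apply Finset.card_nsmul_le_sum
        intro b hbR
        obtain ⟨hbx', hby'⟩ := (hmemR b).mp hbR
        have hbbs : b ≠ bs := fun e => hbsR (e ▸ hbR)
        simpa [hbbs] using hR b hbx' hby'
      rw [hcardR, nsmul_eq_mul] at h2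
      have hm2 : ((m - 2 : ℕ) : ℤ) = (m : ℤ) - 2 := by omega
      rw [hm2] at h2
      linarith
  -- contradiction
  rw [hsplit] at hsum
  have hm' : (4 : ℤ) ≤ m := by exact_mod_cast hm
  by_cases hxbs : x = bs
  · have hcond : ¬ (x ≠ bs ∧ y ≠ bs) := fun h => h.1 hxbs
    rw [if_neg hcond] at hRsum
    linarith
  · have hx2' := hx2 hxbs
    by_cases hybs : y ≠ bs
    · rw [if_pos ⟨hxbs, hybs⟩] at hRsum
      linarith
    · have hcond : ¬ (x ≠ bs ∧ y ≠ bs) := fun h => hybs h.2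
      rw [if_neg hcond] at hRsum
      linarith

end Descent

end LexCore

end Summit.ValiantsHypothesis.ValiantsHypothesis.Theorems.KPlusLogSqLaw
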